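import Mathlib
import Literature.NumberTheory.Automorphic.HilbertModularFormQExpansion
import Summits.Langlands.Langlands.Theorems.CapacityClassicalityHilbertIntegralOverconvergentIsCongruenceStubQIndexEncodingTrace
import Summits.Langlands.Langlands.Theorems.CapacityClassicalityHilbertIntegralOverconvergentIsCongruenceEngineInstanceData

/-!
# Admissible encodings of Hilbert `q`-expansions exist (line `Sketch-ideate-r1-k1`, § T, crux stmt-Langlands-8485)

`hcm_admissible_exists` — the six admissibility clauses of the end-to-end assembly `hilbertClassicalityModuloNamedFacts`
(`1 ≤ d`; `α ≫ 0`; `idx` injective and additive on the cone with the trace formula `|idx ν| = Tr(αν)`; `enc f` carries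
`fourierCoeff f ν` at `idx ν` and `0` off the image of the cone) are satisfiable for every totally real `F` of degree `≥ 2` and
level `𝔫 ≠ 0`: `idx, α` from `stub_qIndex_encoding_trace` (trace basis), `enc` from `eid_qexpRing_of_dict`, and `1 ≤ d` because an
injection of the cone (which contains `0 ≠ 1`) into `ℕ^d` forces `d ≠ 0`.  So a typed crux quantifying `∀` admissible encodings is
not vacuous.
-/

set_option linter.dupNamespace false

noncomputable section

namespace Summit.Langlands.Langlands.Theorems.HilbertIntegralOverconvergentIsCongruence

open MeasureTheory Complex NumberField
open Literature.NumberTheory.Automorphic Literature.NumberTheory.Automorphic.HilbertModular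
open scoped MatrixGroups NumberField

/-- `1` lies in the `q`-expansion index set: `Tr(a) ∈ ℤ` for algebraic integers `a`, and `1 ≫ 0`. [folklore] -/
theorem hcm_one_mem_qIndexSet (F : Type) [Field F] [NumberField F] : (1 : F) ∈ qIndexSet F := by
  refine ⟨fun a ↦ ?_, Or.inr fun σ ↦ by simp⟩
  obtain ⟨n, hn⟩ := (IsIntegrallyClosed.isIntegral_iff (R := ℤ) (K := ℚ)).mp
    (Algebra.isIntegral_trace (NumberField.RingOfIntegers.isIntegral_coe a))
  exact ⟨n, by rw [one_mul, ← hn, eq_intCast]⟩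

/-- **Admissible encodings exist.**  See the module docstring. [folklore] -/
theorem hcm_admissible_exists (F : Type) [Field F] [NumberField F] [NumberField.IsTotallyReal F]
    (hd : 1 < Module.finrank ℚ F) (𝔫 : Ideal (𝓞 F)) (h𝔫 : 𝔫 ≠ ⊥) :
    ∃ (d : ℕ) (idx : F → (Fin d →₀ ℕ)) (α : F) (enc : (Point F → ℂ) → MvPowerSeries (Fin d) ℂ),
      1 ≤ d ∧ (∀ σ : F →+* ℝ, 0 < σ α) ∧ Set.InjOn idx (qIndexSet F) ∧
      (∀ μ ∈ qIndexSet F, ∀ μ' ∈ qIndexSet F, idx (μ + μ') = idx μ + idx μ') ∧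
      (∀ ν ∈ qIndexSet F, ((∑ j, idx ν j : ℕ) : ℚ) = Algebra.trace ℚ F (α * ν)) ∧
      ∀ f : Point F → ℂ, (∀ μ ∈ qIndexSet F, MvPowerSeries.coeff (idx μ) (enc f) = fourierCoeff f μ) ∧
        ∀ n, (∀ μ ∈ qIndexSet F, idx μ ≠ n) → MvPowerSeries.coeff n (enc f) = 0 := by
  obtain ⟨d, idx, α, hα, hinj, hadd, htrace⟩ := stub_qIndex_encoding_trace F
  obtain ⟨enc, henc, -⟩ := eid_qexpRing_of_dict F hd 𝔫 h𝔫 d idx hinj hadd (eid_dict_of_idx F d idx hinj hadd)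
  refine ⟨d, idx, (α : F), enc, ?_, hα, hinj, hadd, htrace, henc⟩
  -- `1 ≤ d`: the cone contains `0 ≠ 1`, and `Fin 0 →₀ ℕ` is a subsingleton
  rcases Nat.eq_zero_or_pos d with rfl | hd0
  · exfalso
    have h01 : idx 0 = idx 1 := Subsingleton.elim _ _
    exact one_ne_zero (hinj (hcm_one_mem_qIndexSet F) zero_mem_qIndexSet h01.symm)
  · exact hd0

end Summit.Langlands.Langlands.Theorems.HilbertIntegralOverconvergentIsCongruence

end
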